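import Summits.AtomisticToContinuum.Crystallization.Theorems.FrustratedLawDichotomyTailFloor
import Mathlib.Analysis.SpecialFunctions.ImproperIntegrals

/-!
# FrustratedLawDichotomy · the tail floor with the LAYER-CAKE constant `A_R = (4/3)(1 + 1/(2R))³/R³`

`…TailFloor.tail_floor` (this hand, p826770) floors the attractive Lennard-Jones tail beyond range `R` over `7/10`-separated clusters by
`−A_R Σ_i min(nn_i,1)⁻³` with the DYADIC constant `A_R = (128/21)(1+1/(4R))³/R³`.  Replacing the dyadic shells by the layer-cake formula
`r⁻⁶ = 6∫_r^∞ t⁻⁷ dt` and the same weighted volume packing `Σ_{r_j ≤ t} min(nn_j,1)³ ≤ 8(t+½)³` gives the weighted far field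
`S_i ≤ 48 ∫_R^∞ t⁻⁷ (t+½)³ dt ≤ 16 (1 + 1/(2R))³ / R³` and hence

  `tail_floor_sharp :  −(4/3)(1 + 1/(2R))³ R⁻³ · Σ_i min(nn_i,1)⁻³ ≤ Σ_{i<j} tailLJ R (r_ij)`   (every `R > 0`),

within a factor `2(1+1/(2R))³(R/(R−1))³` of lens-5 g33's intended mean-value constant `(2/3)(R−1)⁻³` (`1.36×` at `R = 5`).  Literals:
`tail_floor_five` (`A_5 ≤ 71/5000`, bites beneath `T′`: `0.0142·s⋆⁻³ − |t_5| ≈ 1.1·10⁻² < 1.63·10⁻²`) and `tail_floor_eight_sharp`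
(`A_8 ≤ 5/1600`, bites beneath `FDG`: `≈ 2.4·10⁻³ < 3.6·10⁻³`) — lens-5's bite points `R = 5` (T′) and `R = 8` (one above its `7`) are RESTORED.
Also the generic assembly `tail_floor_of_farBound` (any far-field constant `C` ⇒ `A = C/12`).

DEF-FREE; 0 sorry.  Prover hand 1, gen 12 (decomp-a2c), --supports stmt-AtomisticToContinuum-27623.  [folklore: layer cake + packing]
-/

noncomputable section

namespace Summit.AtomisticToContinuum.Crystallization.Theorems.FrustratedLawDichotomyTailFloor

open scoped BigOperators
open Set MeasureTheory
open Literature.MathematicalPhysics.StatisticalMechanics (interactionEnergy lennardJones siteEnergy two_mul_interactionEnergy)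
open Literature.Geometry.DiscreteGeometry (nearestDist nearestDist_nonneg)

variable {N : ℕ}

/-! ## 1. Generic assembly: a weighted far-field constant `C` gives the tail floor with `A = C/12` -/

/-- **Assembly** (the symmetrisation step of `tail_floor`, with the far-field constant abstracted): if at every site the weighted far field is
`≤ C`, then `−(C/12)·Σ_i min(nn_i,1)⁻³ ≤ Σ_{i<j} tailLJ R (r_ij)`. [folklore] -/
theorem tail_floor_of_farBound {R C : ℝ} (hR : 0 < R) (y : Fin N → (EuclideanSpace ℝ (Fin 3)))
    (hsep : ∀ a b : Fin N, a ≠ b → (7 : ℝ) / 10 ≤ dist (y a) (y b))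
    (hS : ∀ i : Fin N, ∑ k, (if R ≤ dist (y k) (y i) then (dist (y k) (y i))⁻¹ ^ 6 * (min (nearestDist y k) 1) ^ 3 else 0) ≤ C) :
    -(C / 12 * ∑ i, ((min (nearestDist y i) 1) ^ 3)⁻¹) ≤
      interactionEnergy (fun r => if r < R then 0 else lennardJones r) y := by
  classical
  set w : Fin N → ℝ := fun j => (min (nearestDist y j) 1) ^ 3 with hw
  set m : Fin N → ℝ := fun j => ((min (nearestDist y j) 1) ^ 3)⁻¹ with hm
  have hm0 : ∀ j, 0 ≤ m j := fun j => inv_nonneg.2 (pow_nonneg (le_min (nearestDist_nonneg y j) zero_le_one) 3)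
  have h2 := two_mul_interactionEnergy (fun r => if r < R then 0 else lennardJones r) y
  have hsite : ∀ i : Fin N, siteEnergy (fun r => if r < R then 0 else lennardJones r) y i =
      ∑ k, (if dist (y i) (y k) < R then 0 else lennardJones (dist (y i) (y k))) := by
    intro i
    unfold siteEnergy
    exact Finset.sum_erase _ (by simp [hR])
  have hsum : -(1 / 12 * (∑ i, m i * ∑ k, (if R ≤ dist (y k) (y i) then (dist (y k) (y i))⁻¹ ^ 6 * w k else 0) +
      ∑ i, m i * ∑ k, (if R ≤ dist (y k) (y i) then (dist (y k) (y i))⁻¹ ^ 6 * w k else 0))) ≤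
      ∑ i, ∑ k, (if dist (y i) (y k) < R then 0 else lennardJones (dist (y i) (y k))) := by
    have hpt := fun i k => tail_pair_ge y hsep hR i k
    have e1 : ∑ i, m i * ∑ k, (if R ≤ dist (y k) (y i) then (dist (y k) (y i))⁻¹ ^ 6 * w k else 0) =
        ∑ i, ∑ k, (if R ≤ dist (y k) (y i) then (dist (y k) (y i))⁻¹ ^ 6 * w k else 0) * m i := by
      refine Finset.sum_congr rfl fun i _ => ?_
      rw [Finset.mul_sum]
      exact Finset.sum_congr rfl fun k _ => by ring
    have e2 : ∑ i, ∑ k, (if R ≤ dist (y i) (y k) then (dist (y i) (y k))⁻¹ ^ 6 * w i else 0) * m k =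
        ∑ i, ∑ k, (if R ≤ dist (y k) (y i) then (dist (y k) (y i))⁻¹ ^ 6 * w k else 0) * m i :=
      Finset.sum_comm
    have e3 : ∑ i, ∑ k, -((1 : ℝ) / 12 *
        ((if R ≤ dist (y k) (y i) then (dist (y k) (y i))⁻¹ ^ 6 * w k else 0) * m i +
          (if R ≤ dist (y i) (y k) then (dist (y i) (y k))⁻¹ ^ 6 * w i else 0) * m k)) =
        -(1 / 12 * (∑ i, ∑ k, (if R ≤ dist (y k) (y i) then (dist (y k) (y i))⁻¹ ^ 6 * w k else 0) * m i +
          ∑ i, ∑ k, (if R ≤ dist (y i) (y k) then (dist (y i) (y k))⁻¹ ^ 6 * w i else 0) * m k)) := by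
      rw [← Finset.sum_add_distrib, Finset.mul_sum, ← Finset.sum_neg_distrib]
      refine Finset.sum_congr rfl fun i _ => ?_
      rw [← Finset.sum_add_distrib, Finset.mul_sum, ← Finset.sum_neg_distrib]
    calc -(1 / 12 * (∑ i, m i * ∑ k, (if R ≤ dist (y k) (y i) then (dist (y k) (y i))⁻¹ ^ 6 * w k else 0) +
          ∑ i, m i * ∑ k, (if R ≤ dist (y k) (y i) then (dist (y k) (y i))⁻¹ ^ 6 * w k else 0)))
        = -(1 / 12 * (∑ i, ∑ k, (if R ≤ dist (y k) (y i) then (dist (y k) (y i))⁻¹ ^ 6 * w k else 0) * m i +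
          ∑ i, ∑ k, (if R ≤ dist (y i) (y k) then (dist (y i) (y k))⁻¹ ^ 6 * w i else 0) * m k)) := by
          rw [e1, e2]
      _ = _ := e3.symm
      _ ≤ ∑ i, ∑ k, (if dist (y i) (y k) < R then 0 else lennardJones (dist (y i) (y k))) :=
          Finset.sum_le_sum fun i _ => Finset.sum_le_sum fun k _ => hpt i k
  have hA : ∑ i, m i * ∑ k, (if R ≤ dist (y k) (y i) then (dist (y k) (y i))⁻¹ ^ 6 * w k else 0) ≤ C * ∑ i, m i := by
    rw [Finset.mul_sum]
    refine Finset.sum_le_sum fun i _ => ?_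
    rw [mul_comm C]
    exact mul_le_mul_of_nonneg_left (hS i) (hm0 i)
  have hU : 2 * interactionEnergy (fun r => if r < R then 0 else lennardJones r) y =
      ∑ i, ∑ k, (if dist (y i) (y k) < R then 0 else lennardJones (dist (y i) (y k))) := by
    rw [h2]; exact Finset.sum_congr rfl fun i _ => hsite i
  have hfin : -(1 / 12 * (C * ∑ i, m i + C * ∑ i, m i)) ≤ 2 * interactionEnergy (fun r => if r < R then 0 else lennardJones r) y := by
    rw [hU]
    refine le_trans ?_ hsum
    have := add_le_add hA hA
    linarith
  have hCm : C / 12 * ∑ i, ((min (nearestDist y i) 1) ^ 3)⁻¹ = 1 / 12 * C * ∑ i, m i := by ring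
  rw [hCm]
  linarith

/-! ## 2. The weighted far field by layer cake: `S_i ≤ 16 (1 + 1/(2R))³ / R³` -/

/-- `r⁻⁶ = 6 ∫_r^∞ t⁻⁷ dt` for `r > 0`. [folklore] -/
theorem inv_pow_six_eq_integral {r : ℝ} (hr : 0 < r) :
    (r⁻¹) ^ 6 = 6 * ∫ t in Ioi r, t ^ (-7 : ℝ) := by
  rw [integral_Ioi_rpow_of_lt (by norm_num) hr]
  have h6 : r ^ ((-7 : ℝ) + 1) = (r ^ 6)⁻¹ := by
    rw [show (-7 : ℝ) + 1 = -(6 : ℕ) by norm_num, Real.rpow_neg hr.le, Real.rpow_natCast]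
  rw [h6, inv_pow]
  ring

/-- **The weighted far field at a site, layer-cake constant**: for `R > 0` and any centre `p`,
`Σ_{j : dist (y j) p ≥ R} r_j⁻⁶ · min(nn_j,1)³ ≤ 16 (1 + 1/(2R))³ / R³`. [folklore] -/
theorem sum_far_weight_le_sharp (y : Fin N → (EuclideanSpace ℝ (Fin 3)))
    (hsep : ∀ a b : Fin N, a ≠ b → (7 : ℝ) / 10 ≤ dist (y a) (y b))
    (p : (EuclideanSpace ℝ (Fin 3))) {R : ℝ} (hR : 0 < R) (s : Finset (Fin N)) (hfar : ∀ j ∈ s, R ≤ dist (y j) p) :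
    ∑ j ∈ s, (dist (y j) p)⁻¹ ^ 6 * (min (nearestDist y j) 1) ^ 3 ≤ 16 * (1 + 1 / (2 * R)) ^ 3 / R ^ 3 := by
  classical
  set w : Fin N → ℝ := fun j => (min (nearestDist y j) 1) ^ 3 with hw
  have hw0 : ∀ j, 0 ≤ w j := fun j => pow_nonneg (le_min (nearestDist_nonneg y j) zero_le_one) 3
  have hdpos : ∀ j ∈ s, 0 < dist (y j) p := fun j hj => hR.trans_le (hfar j hj)
  -- integrability facts on `Ioi R`
  have hint7 : IntegrableOn (fun t : ℝ => t ^ (-7 : ℝ)) (Ioi R) := integrableOn_Ioi_rpow_of_lt (by norm_num) hR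
  have hint4 : IntegrableOn (fun t : ℝ => t ^ (-4 : ℝ)) (Ioi R) := integrableOn_Ioi_rpow_of_lt (by norm_num) hR
  -- layer cake for each term
  have hterm : ∀ j ∈ s, (dist (y j) p)⁻¹ ^ 6 * w j =
      ∫ t in Ioi R, (Ioi (dist (y j) p)).indicator (fun t : ℝ => 6 * w j * t ^ (-7 : ℝ)) t := by
    intro j hj
    rw [setIntegral_indicator measurableSet_Ioi, Set.Ioi_inter_Ioi, sup_eq_right.2 (hfar j hj),
      inv_pow_six_eq_integral (hdpos j hj)]
    rw [show (fun t : ℝ => 6 * w j * t ^ (-7 : ℝ)) = fun t => (6 * w j) * t ^ (-7 : ℝ) from rfl,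
      integral_const_mul]
    ring
  have hint_term : ∀ j ∈ s, IntegrableOn (fun t => (Ioi (dist (y j) p)).indicator (fun t : ℝ => 6 * w j * t ^ (-7 : ℝ)) t)
      (Ioi R) := by
    intro j hj
    exact (hint7.const_mul (6 * w j)).indicator measurableSet_Ioi
  -- the sum as one integral
  have hsum_eq : ∑ j ∈ s, (dist (y j) p)⁻¹ ^ 6 * w j =
      ∫ t in Ioi R, ∑ j ∈ s, (Ioi (dist (y j) p)).indicator (fun t : ℝ => 6 * w j * t ^ (-7 : ℝ)) t := by
    rw [integral_finsetSum _ hint_term]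
    exact Finset.sum_congr rfl hterm
  -- pointwise bound of the integrand by the weighted packing
  have hpt : ∀ t ∈ Ioi R, ∑ j ∈ s, (Ioi (dist (y j) p)).indicator (fun t : ℝ => 6 * w j * t ^ (-7 : ℝ)) t ≤
      48 * (1 + 1 / (2 * R)) ^ 3 * t ^ (-4 : ℝ) := by
    intro t ht
    have htR : R < t := ht
    have ht0 : 0 < t := hR.trans htR
    have hind : ∀ j ∈ s, (Ioi (dist (y j) p)).indicator (fun t : ℝ => 6 * w j * t ^ (-7 : ℝ)) t =
        if dist (y j) p < t then 6 * t ^ (-7 : ℝ) * w j else 0 := by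
      intro j _
      simp only [Set.indicator, Set.mem_Ioi]
      split_ifs <;> ring
    rw [Finset.sum_congr rfl hind, ← Finset.sum_filter, ← Finset.mul_sum]
    have hW : ∑ j ∈ s.filter (fun j => dist (y j) p < t), w j ≤ 8 * (t + 1 / 2) ^ 3 :=
      sum_weight_le_of_dist_le y hsep p ht0.le _ fun j hj => (Finset.mem_filter.1 hj).2.le
    have h7 : 0 ≤ 6 * t ^ (-7 : ℝ) := by positivity
    have hcube : (t + 1 / 2) ^ 3 ≤ (1 + 1 / (2 * R)) ^ 3 * t ^ 3 := by
      have h1 : t + 1 / 2 ≤ (1 + 1 / (2 * R)) * t := by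
        rw [add_mul, one_mul, add_le_add_iff_left, div_mul_eq_mul_div, le_div_iff₀ (by positivity)]
        linarith
      calc (t + 1 / 2) ^ 3 ≤ ((1 + 1 / (2 * R)) * t) ^ 3 := pow_le_pow_left₀ (by positivity) h1 3
        _ = (1 + 1 / (2 * R)) ^ 3 * t ^ 3 := by ring
    have h74 : t ^ (-7 : ℝ) * t ^ 3 = t ^ (-4 : ℝ) := by
      rw [← Real.rpow_natCast t 3, ← Real.rpow_add ht0]
      norm_num
    calc 6 * t ^ (-7 : ℝ) * ∑ j ∈ s.filter (fun j => dist (y j) p < t), w j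
        ≤ 6 * t ^ (-7 : ℝ) * (8 * (t + 1 / 2) ^ 3) := mul_le_mul_of_nonneg_left hW h7
      _ ≤ 6 * t ^ (-7 : ℝ) * (8 * ((1 + 1 / (2 * R)) ^ 3 * t ^ 3)) := by gcongr
      _ = 48 * (1 + 1 / (2 * R)) ^ 3 * (t ^ (-7 : ℝ) * t ^ 3) := by ring
      _ = 48 * (1 + 1 / (2 * R)) ^ 3 * t ^ (-4 : ℝ) := by rw [h74]
  -- integrate
  have hint_sum : IntegrableOn (fun t => ∑ j ∈ s, (Ioi (dist (y j) p)).indicator (fun t : ℝ => 6 * w j * t ^ (-7 : ℝ)) t)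
      (Ioi R) := integrable_finsetSum _ hint_term
  have hI4 : ∫ t in Ioi R, 48 * (1 + 1 / (2 * R)) ^ 3 * t ^ (-4 : ℝ) = 16 * (1 + 1 / (2 * R)) ^ 3 / R ^ 3 := by
    rw [integral_const_mul, integral_Ioi_rpow_of_lt (by norm_num) hR]
    have h3 : R ^ ((-4 : ℝ) + 1) = (R ^ 3)⁻¹ := by
      rw [show (-4 : ℝ) + 1 = -(3 : ℕ) by norm_num, Real.rpow_neg hR.le, Real.rpow_natCast]
    rw [h3]
    field_simp
    ring
  calc ∑ j ∈ s, (dist (y j) p)⁻¹ ^ 6 * w j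
      = ∫ t in Ioi R, ∑ j ∈ s, (Ioi (dist (y j) p)).indicator (fun t : ℝ => 6 * w j * t ^ (-7 : ℝ)) t := hsum_eq
    _ ≤ ∫ t in Ioi R, 48 * (1 + 1 / (2 * R)) ^ 3 * t ^ (-4 : ℝ) :=
        setIntegral_mono_on hint_sum (hint4.const_mul _) measurableSet_Ioi hpt
    _ = 16 * (1 + 1 / (2 * R)) ^ 3 / R ^ 3 := hI4

/-! ## 3. The tail floor with the layer-cake constant, and literals -/

/-- **THE TAIL FLOOR, layer-cake constant**: for every `R > 0` and every `7/10`-separated finite cluster,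
`−(4/3)(1 + 1/(2R))³/R³ · Σ_i min(nn_i,1)⁻³ ≤ Σ_{i<j} tailLJ R (r_ij)`. [folklore] -/
theorem tail_floor_sharp {R : ℝ} (hR : 0 < R) (N : ℕ) (y : Fin N → (EuclideanSpace ℝ (Fin 3)))
    (hsep : ∀ a b : Fin N, a ≠ b → (7 : ℝ) / 10 ≤ dist (y a) (y b)) :
    -(4 / 3 * (1 + 1 / (2 * R)) ^ 3 / R ^ 3 * ∑ i, ((min (nearestDist y i) 1) ^ 3)⁻¹) ≤
      interactionEnergy (fun r => if r < R then 0 else lennardJones r) y := by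
  classical
  have hS : ∀ i : Fin N, ∑ k, (if R ≤ dist (y k) (y i) then (dist (y k) (y i))⁻¹ ^ 6 * (min (nearestDist y k) 1) ^ 3 else 0) ≤
      16 * (1 + 1 / (2 * R)) ^ 3 / R ^ 3 := by
    intro i
    rw [← Finset.sum_filter]
    exact sum_far_weight_le_sharp y hsep (y i) hR _ fun k hk => (Finset.mem_filter.1 hk).2
  have h := tail_floor_of_farBound hR y hsep hS
  have hc : 16 * (1 + 1 / (2 * R)) ^ 3 / R ^ 3 / 12 = 4 / 3 * (1 + 1 / (2 * R)) ^ 3 / R ^ 3 := by ring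
  rwa [hc] at h

/-- Literal at `R = 5`: `A_5 = (4/3)(11/10)³/125 ≤ 71/5000` — bites beneath lens-5 g33's `T′` ceiling `1.63·10⁻²`
(`0.0142·s⋆⁻³ − |t_5| ≈ 1.1·10⁻²`): the bite point `R = 5` of the range cut is RESTORED with a proved tail floor. [folklore] -/
theorem tail_floor_five (N : ℕ) (y : Fin N → (EuclideanSpace ℝ (Fin 3)))
    (hsep : ∀ a b : Fin N, a ≠ b → (7 : ℝ) / 10 ≤ dist (y a) (y b)) :
    -(71 / 5000 * ∑ i, ((min (nearestDist y i) 1) ^ 3)⁻¹) ≤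
      interactionEnergy (fun r => if r < 5 then 0 else lennardJones r) y := by
  have h := tail_floor_sharp (R := 5) (by norm_num) N y hsep
  have hs : 0 ≤ ∑ i, ((min (nearestDist y i) 1) ^ 3)⁻¹ :=
    Finset.sum_nonneg fun i _ => inv_nonneg.2 (pow_nonneg (le_min (nearestDist_nonneg y i) zero_le_one) 3)
  have hc : (4 : ℝ) / 3 * (1 + 1 / (2 * 5)) ^ 3 / 5 ^ 3 ≤ 71 / 5000 := by norm_num
  nlinarith

/-- Literal at `R = 8`: `A_8 = (4/3)(17/16)³/512 ≤ 5/1600` — bites beneath the `FDG` ceiling `3.6·10⁻³` of the unsplit range cut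
(`(5/1600)·s⋆⁻³ − |t_8| ≈ 2.4·10⁻³`). [folklore] -/
theorem tail_floor_eight_sharp (N : ℕ) (y : Fin N → (EuclideanSpace ℝ (Fin 3)))
    (hsep : ∀ a b : Fin N, a ≠ b → (7 : ℝ) / 10 ≤ dist (y a) (y b)) :
    -(5 / 1600 * ∑ i, ((min (nearestDist y i) 1) ^ 3)⁻¹) ≤
      interactionEnergy (fun r => if r < 8 then 0 else lennardJones r) y := by
  have h := tail_floor_sharp (R := 8) (by norm_num) N y hsep
  have hs : 0 ≤ ∑ i, ((min (nearestDist y i) 1) ^ 3)⁻¹ :=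
    Finset.sum_nonneg fun i _ => inv_nonneg.2 (pow_nonneg (le_min (nearestDist_nonneg y i) zero_le_one) 3)
  have hc : (4 : ℝ) / 3 * (1 + 1 / (2 * 8)) ^ 3 / 8 ^ 3 ≤ 5 / 1600 := by norm_num
  nlinarith

end Summit.AtomisticToContinuum.Crystallization.Theorems.FrustratedLawDichotomyTailFloor
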